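import Summits.QuantumFields.YangMills.Theorems.BalabanUVNodesPortS1Frame
import Summits.QuantumFields.YangMills.Theorems.BalabanUVNodesPortU2Chart
import Summits.QuantumFields.YangMills.Theorems.BalabanUVNodesK0RecordFormatNamesLemmas2

/-!
# NODE O port PT-A (second hand), [RG-I] §4 (4.7)–(4.15) AT THE RECORD, part 1 — the Ward–Takahashi ROWS: «the group G is semisimple» and
# «(4.8) with a constant λ» PROVED for the record's charts (both chart editions)

Cell `ym-nodeO-ideate` ∕ programme cell `ym-balaban-port`, porter seat `ymgap-nodeO-port-PTA-2` (gen 0; the second hand on PORT item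
`stmt-QuantumFields-27930` `PortRecordRepresentationS1`, share [RG-I] §4–§5 per port-lead RULING L-1 (4)); PORT-PLAN row **S4-B** ([I] §4 (4.7)–(4.15)
p. 282–284); `--supports stmt-QuantumFields-27930 --as helper` (count-neutral).  [I] = [Balaban1987RG1] = T. Bałaban, *Renormalization group approach to
lattice gauge field theories. I*, Commun. Math. Phys. **109** (1987) 249–301 (held `paper:balaban1987-cmp109-rg-i-small-field`, journal page = PDF page + 248;
pp. 281–292 re-read by this seat).

WHAT IS PRINTED (verbatim).  p. 282–283: *"Take a function E(V) defined and analytic on a domain of small gauge field configurations V on a unit lattice, and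
assume that it is gauge invariant, i.e., E(V^v) = E(V) (4.7) … For a small gauge field V = exp iB, and a small gauge transformation v = exp iλ, B and λ small,
we have V^v(b) = exp iλ(b₋) exp iB(b) exp(−iλ(b₊)) … (4.8)"*; p. 284: *"Consider at first (4.10) at B = 0 … (4.13). For constant λ we get ⟨(δ∕δB)𝐄(1), i ad_λ
B₁⟩ = 0, and since the configuration B₁ is arbitrary, we get [λ, (δ∕δB)𝐄(1)] = 0 for all λ ∈ 𝔤ᶜ. The group G is semisimple, hence this is possible only
for the element 0 in the algebra 𝔤ᶜ. Thus we have the first, very important consequence of the gauge invariance (δ∕δB)𝐄(1) = 0. (4.14) This equality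
simplifies the identities, and also the sum (4.6), we can drop the term with n = 1."*

WHAT IS TYPED HERE (the record side of typer-1's §6–§7 of `B12FormatPlus`: `NoInvariantCovector`, `ChartEquivariant`, `ward414_of_gaugeInv119`,
`formatPlusW_of_formatPlusG` — there GENERIC and over the polydisc `Chart44`; here AT DEF-1's NAMES and over the scaled domain `Chart44D`):
* §1 two constant rotations `diag(i, −i)`, `[[0, 1], [−1, 0]] ∈ SU(2)` and their adjoint action in the record's 𝔰𝔩₂-coordinates (bookkeeping).
* §2 ★ `noInvariantCovectorAt F K : NoInvariantCovectorAt F K` and ★ `noInvariantCovectorAtJ F K : NoInvariantCovectorAtJ F K` — «G is semisimple» for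
  `G = SU(2)` in the record's chart coordinates (lens-1's semisimplicity ROW, both chart editions), PROVED: an `Ad(SU(2))`-invariant covector on
  `(𝔰𝔩₂(ℂ))^{bonds}` (resp. `(𝔰𝔩₂(ℂ) ⊕ 𝔰𝔩₂(ℂ))^{bonds}`) vanishes.
* §3 ★ `chartEquivariantAt F Mc k : ChartEquivariantAt F Mc k` and ★ `chartEquivariantAtJ F Mc k : ChartEquivariantAtJ F Mc k` — (4.8) with a constant `λ`
  for the record's exp-chart cut to `X` (`recordChart`, and the two-block `recordChartJ` of the (R-J) edition) against the (1.10) action `recordAct` of the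
  constant gauge transformation `recordToG h`: `exp(Ad_h W) = h·exp(W)·h⁻¹` (Mathlib `Matrix.exp_units_conj`), PROVED.
The consequence (1.19) ⟹ (4.14) on print's scaled (4.4)-domain, generic and at the record, is part 2 (`BalabanUVNodesPortS1Sect4Ward`, same seat): with it the
Ward row (4.14), which [I] §4 uses to *"drop the term with n = 1"* and to reach (4.35) p. 290, costs the port NOTHING beyond 27930 ∧ 27932 — its two pieces-free
inputs («G semisimple», chart equivariance) are the theorems of this file.

HONEST FRAMING.  Representation theory of `SU(2)` on the record's chart coordinates + the exponential's conjugation law; nothing of Bałaban's estimates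
((4.5), (4.17)–(4.18), (4.22), §5) is asserted, ported or discharged here; 27930 stays OPEN; K0⁷ NOT closed; NODE O 0∕1; COUNT 8∕28 · K 1∕4 UNMOVED; finite `𝕋⁴_{L^K}` at fixed ε — NOT continuum ∕ OS ∕ Clay; **the
Yang–Mills mass gap is NOT proved by any of this.**  No `sorry`, no `def`, no `instance`; standard axioms.
-/

noncomputable section

open scoped BigOperators Matrix.Norms.L2Operator Topology

namespace Summit.QuantumFields.YangMills.Theorems.BalabanUVNodesPortS1

open Summit.QuantumFields.YangMills.Theorems.K0RecordFormatNames
open Literature.MathematicalPhysics.QuantumFieldTheory.Balaban1983to89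
open Literature.MathematicalPhysics.QuantumFieldTheory.Balaban1983to89.Node00
open Literature.MathematicalPhysics.QuantumFieldTheory.Balaban1983to89.T4Continuum (T4Family)
open NormedSpace (exp)
open _root_.Filter

variable (F : T4Family)

/-! ## §1  Two constant rotations of `G = SU(2)` and their adjoint action in 𝔰𝔩₂-coordinates ([I] p.284: «For constant λ …») -/

/-- The diagonal rotation `diag(i, −i)` lies in `SU(2)`. [cite: Balaban1987RG1, (4.13) p.284 (constant λ; bookkeeping)] -/
theorem rotDiag_mem : (!![Complex.I, 0; 0, -Complex.I] : MatA 2) ∈ Matrix.specialUnitaryGroup (Fin 2) ℂ := by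
  rw [Matrix.mem_specialUnitaryGroup_iff, Matrix.mem_unitaryGroup_iff]
  refine ⟨?_, by simp [Matrix.det_fin_two]⟩
  have hs : star (!![Complex.I, 0; 0, -Complex.I] : MatA 2) = !![-Complex.I, 0; 0, Complex.I] := by
    ext i j; fin_cases i <;> fin_cases j <;> simp [Matrix.star_apply]
  rw [hs, Matrix.mul_fin_two]
  ext i j; fin_cases i <;> fin_cases j <;> simp

/-- The Weyl rotation `[[0, 1], [−1, 0]]` lies in `SU(2)`. [cite: Balaban1987RG1, (4.13) p.284 (constant λ; bookkeeping)] -/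
theorem rotWeyl_mem : (!![0, 1; -1, 0] : MatA 2) ∈ Matrix.specialUnitaryGroup (Fin 2) ℂ := by
  rw [Matrix.mem_specialUnitaryGroup_iff, Matrix.mem_unitaryGroup_iff]
  refine ⟨?_, by simp [Matrix.det_fin_two]⟩
  have hs : star (!![0, 1; -1, 0] : MatA 2) = !![0, -1; 1, 0] := by
    ext i j; fin_cases i <;> fin_cases j <;> simp [Matrix.star_apply]
  rw [hs, Matrix.mul_fin_two]
  ext i j; fin_cases i <;> fin_cases j <;> simp

/-- The inverse in `SU(2)` is the conjugate transpose, as a matrix. [cite: Balaban1987RG1, (1.10) p.262 (bookkeeping)] -/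
theorem coe_inv_SU2 (h : SU 2) : ((h⁻¹ : SU 2) : MatA 2) = star (h : MatA 2) := by
  rw [← Matrix.star_eq_inv]; rfl

/-- The inverse in `SU(2)` read through the unit embedding `ιSU`. [cite: Balaban1987RG1, (1.10) p.262 (bookkeeping)] -/
theorem coe_inv_SU2_eq_units_inv (h : SU 2) : ((h⁻¹ : SU 2) : MatA 2) = (((ιSU 2 h)⁻¹ : (MatA 2)ˣ) : MatA 2) := by
  rw [← map_inv]; rfl

/-- `sl2Coord` of a conjugate by `diag(i, −i)`: the `E`- and `F`-coordinates flip sign, the `H`-coordinate is fixed.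
[cite: Balaban1987RG1, (4.13) p.284 (bookkeeping)] -/
theorem sl2Coord_conj_rotDiag (M : MatA 2) :
    sl2Coord (((⟨_, rotDiag_mem⟩ : SU 2) : MatA 2) * M * (((⟨_, rotDiag_mem⟩ : SU 2)⁻¹ : SU 2) : MatA 2)) =
      ![-(sl2Coord M 0), -(sl2Coord M 1), sl2Coord M 2] := by
  have hinv : ((((⟨_, rotDiag_mem⟩ : SU 2)⁻¹ : SU 2) : MatA 2)) = !![-Complex.I, 0; 0, Complex.I] := by
    rw [coe_inv_SU2]
    change star (!![Complex.I, 0; 0, -Complex.I] : MatA 2) = _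
    ext i j; fin_cases i <;> fin_cases j <;> simp [Matrix.star_apply]
  have hg : (((⟨_, rotDiag_mem⟩ : SU 2) : MatA 2)) = !![Complex.I, 0; 0, -Complex.I] := rfl
  rw [hinv, hg, Matrix.eta_fin_two M, Matrix.mul_fin_two, Matrix.mul_fin_two]
  ext a
  fin_cases a
  · simp [sl2Coord]; linear_combination (M 0 1) * Complex.I_sq
  · simp [sl2Coord]; linear_combination (M 1 0) * Complex.I_sq
  · simp [sl2Coord]; linear_combination (M 1 1 - M 0 0) * Complex.I_sq

/-- `sl2Coord` of a conjugate by the Weyl rotation: `(c_E, c_F, c_H) ↦ (−c_F, −c_E, −c_H)`. [cite: Balaban1987RG1, (4.13) p.284 (bookkeeping)] -/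
theorem sl2Coord_conj_rotWeyl (M : MatA 2) :
    sl2Coord (((⟨_, rotWeyl_mem⟩ : SU 2) : MatA 2) * M * (((⟨_, rotWeyl_mem⟩ : SU 2)⁻¹ : SU 2) : MatA 2)) =
      ![-(sl2Coord M 1), -(sl2Coord M 0), -(sl2Coord M 2)] := by
  have hinv : ((((⟨_, rotWeyl_mem⟩ : SU 2)⁻¹ : SU 2) : MatA 2)) = !![0, -1; 1, 0] := by
    rw [coe_inv_SU2]
    change star (!![0, 1; -1, 0] : MatA 2) = _
    ext i j; fin_cases i <;> fin_cases j <;> simp [Matrix.star_apply]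
  have hg : (((⟨_, rotWeyl_mem⟩ : SU 2) : MatA 2)) = !![0, 1; -1, 0] := rfl
  rw [hinv, hg, Matrix.eta_fin_two M, Matrix.mul_fin_two, Matrix.mul_fin_two]
  ext a
  fin_cases a
  · simp [sl2Coord]
  · simp [sl2Coord]
  · simp [sl2Coord]; ring

/-- The chart matrix read back in 𝔰𝔩₂-coordinates: `sl2Coord (Σ_a w_{b,a} τ_a) = (w_{b,a})_a`. [cite: Balaban1987RG1, p.258 (local coordinates; bookkeeping)] -/
theorem sl2Coord_chartMat (K : ℕ) (w : Fin (recordChartDim F K) → ℂ) (b : PBond (F.P K) 0) (a : Fin 3) :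
    sl2Coord (chartMat F K w b) a = w (chartEquiv F K (b, a)) := by
  fin_cases a <;> simp [sl2Coord, chartMat, sl2Gen, Fin.sum_univ_three]

/-- The `𝐔`-block chart matrix read back in 𝔰𝔩₂-coordinates. [cite: Balaban1987RG1, (1.9) p.261 (bookkeeping)] -/
theorem sl2Coord_chartMatU (K : ℕ) (w : Fin (recordChartDimJ F K) → ℂ) (b : PBond (F.P K) 0) (a : Fin 3) :
    sl2Coord (chartMatU F K w b) a = w (chartEquivJ F K (b, Sum.inl a)) := by
  fin_cases a <;> simp [sl2Coord, chartMatU, sl2Gen, Fin.sum_univ_three]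

/-- The `𝐉`-block chart matrix read back in 𝔰𝔩₂-coordinates. [cite: Balaban1987RG1, (1.9) p.261 (bookkeeping)] -/
theorem sl2Coord_chartMatJc (K : ℕ) (w : Fin (recordChartDimJ F K) → ℂ) (b : PBond (F.P K) 0) (a : Fin 3) :
    sl2Coord (chartMatJc F K w b) a = w (chartEquivJ F K (b, Sum.inr a)) := by
  fin_cases a <;> simp [sl2Coord, chartMatJc, sl2Gen, Fin.sum_univ_three]

/-- The record's adjoint action, coordinatewise (definitional). [cite: Balaban1987RG1, (4.8) p.283 (bookkeeping)] -/
theorem recordAd_apply (K : ℕ) (g : SU 2) (w : Fin (recordChartDim F K) → ℂ) (i : Fin (recordChartDim F K)) :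
    recordAd F K g w i =
      sl2Coord ((g : MatA 2) * chartMat F K w ((chartEquiv F K).symm i).1 * ((g⁻¹ : SU 2) : MatA 2)) ((chartEquiv F K).symm i).2 :=
  rfl

/-- The two-block adjoint action, coordinatewise (definitional). [cite: Balaban1987RG1, (1.10) p.262, (4.8) p.283 (bookkeeping)] -/
theorem recordAdJ_apply (K : ℕ) (g : SU 2) (w : Fin (recordChartDimJ F K) → ℂ) (i : Fin (recordChartDimJ F K)) :
    recordAdJ F K g w i =
      Sum.elim (fun a => sl2Coord ((g : MatA 2) * chartMatU F K w ((chartEquivJ F K).symm i).1 * ((g⁻¹ : SU 2) : MatA 2)) a)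
        (fun a => sl2Coord ((g : MatA 2) * chartMatJc F K w ((chartEquivJ F K).symm i).1 * ((g⁻¹ : SU 2) : MatA 2)) a)
        ((chartEquivJ F K).symm i).2 :=
  rfl

/-- The diagonal rotation on the record's chart coordinates of a bond: `(w_E, w_F, w_H) ↦ (−w_E, −w_F, w_H)`. [cite: Balaban1987RG1, (4.13) p.284 (bookkeeping)] -/
theorem recordAd_rotDiag (K : ℕ) (w : Fin (recordChartDim F K) → ℂ) (b : PBond (F.P K) 0) (a : Fin 3) :
    recordAd F K ⟨_, rotDiag_mem⟩ w (chartEquiv F K (b, a)) =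
      ![-(w (chartEquiv F K (b, 0))), -(w (chartEquiv F K (b, 1))), w (chartEquiv F K (b, 2))] a := by
  rw [recordAd_apply, Equiv.symm_apply_apply, sl2Coord_conj_rotDiag]
  fin_cases a <;> simp [sl2Coord_chartMat]

/-- The Weyl rotation on the record's chart coordinates of a bond: `(w_E, w_F, w_H) ↦ (−w_F, −w_E, −w_H)`. [cite: Balaban1987RG1, (4.13) p.284 (bookkeeping)] -/
theorem recordAd_rotWeyl (K : ℕ) (w : Fin (recordChartDim F K) → ℂ) (b : PBond (F.P K) 0) (a : Fin 3) :
    recordAd F K ⟨_, rotWeyl_mem⟩ w (chartEquiv F K (b, a)) =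
      ![-(w (chartEquiv F K (b, 1))), -(w (chartEquiv F K (b, 0))), -(w (chartEquiv F K (b, 2)))] a := by
  rw [recordAd_apply, Equiv.symm_apply_apply, sl2Coord_conj_rotWeyl]
  fin_cases a <;> simp [sl2Coord_chartMat]

/-- The diagonal rotation on the two-block coordinates of a bond, `𝐔`-block. [cite: Balaban1987RG1, (4.13) p.284 (bookkeeping)] -/
theorem recordAdJ_rotDiag_inl (K : ℕ) (w : Fin (recordChartDimJ F K) → ℂ) (b : PBond (F.P K) 0) (a : Fin 3) :
    recordAdJ F K ⟨_, rotDiag_mem⟩ w (chartEquivJ F K (b, Sum.inl a)) =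
      ![-(w (chartEquivJ F K (b, Sum.inl 0))), -(w (chartEquivJ F K (b, Sum.inl 1))), w (chartEquivJ F K (b, Sum.inl 2))] a := by
  rw [recordAdJ_apply, Equiv.symm_apply_apply, Sum.elim_inl, sl2Coord_conj_rotDiag]
  fin_cases a <;> simp [sl2Coord_chartMatU]

/-- The diagonal rotation on the two-block coordinates of a bond, `𝐉`-block. [cite: Balaban1987RG1, (4.13) p.284 (bookkeeping)] -/
theorem recordAdJ_rotDiag_inr (K : ℕ) (w : Fin (recordChartDimJ F K) → ℂ) (b : PBond (F.P K) 0) (a : Fin 3) :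
    recordAdJ F K ⟨_, rotDiag_mem⟩ w (chartEquivJ F K (b, Sum.inr a)) =
      ![-(w (chartEquivJ F K (b, Sum.inr 0))), -(w (chartEquivJ F K (b, Sum.inr 1))), w (chartEquivJ F K (b, Sum.inr 2))] a := by
  rw [recordAdJ_apply, Equiv.symm_apply_apply, Sum.elim_inr, sl2Coord_conj_rotDiag]
  fin_cases a <;> simp [sl2Coord_chartMatJc]

/-- The Weyl rotation on the two-block coordinates of a bond, `𝐔`-block. [cite: Balaban1987RG1, (4.13) p.284 (bookkeeping)] -/
theorem recordAdJ_rotWeyl_inl (K : ℕ) (w : Fin (recordChartDimJ F K) → ℂ) (b : PBond (F.P K) 0) (a : Fin 3) :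
    recordAdJ F K ⟨_, rotWeyl_mem⟩ w (chartEquivJ F K (b, Sum.inl a)) =
      ![-(w (chartEquivJ F K (b, Sum.inl 1))), -(w (chartEquivJ F K (b, Sum.inl 0))), -(w (chartEquivJ F K (b, Sum.inl 2)))] a := by
  rw [recordAdJ_apply, Equiv.symm_apply_apply, Sum.elim_inl, sl2Coord_conj_rotWeyl]
  fin_cases a <;> simp [sl2Coord_chartMatU]

/-- The Weyl rotation on the two-block coordinates of a bond, `𝐉`-block. [cite: Balaban1987RG1, (4.13) p.284 (bookkeeping)] -/
theorem recordAdJ_rotWeyl_inr (K : ℕ) (w : Fin (recordChartDimJ F K) → ℂ) (b : PBond (F.P K) 0) (a : Fin 3) :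
    recordAdJ F K ⟨_, rotWeyl_mem⟩ w (chartEquivJ F K (b, Sum.inr a)) =
      ![-(w (chartEquivJ F K (b, Sum.inr 1))), -(w (chartEquivJ F K (b, Sum.inr 0))), -(w (chartEquivJ F K (b, Sum.inr 2)))] a := by
  rw [recordAdJ_apply, Equiv.symm_apply_apply, Sum.elim_inr, sl2Coord_conj_rotWeyl]
  fin_cases a <;> simp [sl2Coord_chartMatJc]

/-! ## §2  ★ «The group G is semisimple» AT THE RECORD ([I] p.284, the step (4.13) ⟹ (4.14)): no invariant covector for the adjoint action of the
constant rotations on the record's chart coordinates — lens-1's ROW `NoInvariantCovectorAt(J)`, PROVED for both chart editions -/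

/-- **★ `NoInvariantCovectorAt F K` HOLDS** — print p.284: *"we get [λ, (δ∕δB)𝐄(1)] = 0 for all λ ∈ 𝔤ᶜ. The group G is semisimple, hence this is possible
only for the element 0 in the algebra 𝔤ᶜ"* — in the record's chart coordinates (three 𝔰𝔩₂(ℂ)-colours per fine bond, `recordAd` = bondwise `Ad`): a
`ℂ`-linear functional on the chart inputs invariant under `Ad_g` for all `g ∈ SU(2)` vanishes.  Two rotations suffice: `diag(i, −i)` flips the `E, F` colours
(so the functional factors through the `H`-colours) and the Weyl rotation flips the `H`-colour. [cite: Balaban1987RG1, (4.13)–(4.14) p.284] -/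
theorem noInvariantCovectorAt (K : ℕ) : NoInvariantCovectorAt F K := by
  classical
  intro φ hφ
  have hinv : ∀ (g : SU 2) (w : Fin (recordChartDim F K) → ℂ), φ (recordAd F K g w) = φ w := fun g w => by
    simpa using DFunLike.congr_fun (hφ g) w
  -- the `H`-colour part of a coordinate vector
  let P : (Fin (recordChartDim F K) → ℂ) → (Fin (recordChartDim F K) → ℂ) := fun w i =>
    if ((chartEquiv F K).symm i).2 = 2 then w i else 0
  have h1 : ∀ w, w + recordAd F K ⟨_, rotDiag_mem⟩ w = (2 : ℂ) • P w := by
    intro w; ext i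
    obtain ⟨⟨b, a⟩, rfl⟩ := (chartEquiv F K).surjective i
    rw [Pi.add_apply, Pi.smul_apply, recordAd_rotDiag]
    fin_cases a
    · simp [P]
    · simp [P]
    · simp [P]; ring
  have h2 : ∀ w, recordAd F K ⟨_, rotWeyl_mem⟩ (P w) = -P w := by
    intro w; ext i
    obtain ⟨⟨b, a⟩, rfl⟩ := (chartEquiv F K).surjective i
    rw [Pi.neg_apply, recordAd_rotWeyl]
    fin_cases a <;> simp [P]
  have hP : ∀ w, φ (P w) = 0 := by
    intro w
    have h := hinv ⟨_, rotWeyl_mem⟩ (P w)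
    rw [h2, map_neg] at h
    linear_combination (-1 / 2 : ℂ) * h
  refine ContinuousLinearMap.ext fun w => ?_
  have h3 : φ (w + recordAd F K ⟨_, rotDiag_mem⟩ w) = 2 * φ w := by rw [map_add, hinv]; ring
  rw [h1, map_smul, hP, smul_zero] at h3
  show φ w = 0
  linear_combination (-1 / 2 : ℂ) * h3

/-- **★ `NoInvariantCovectorAtJ F K` HOLDS** — the same for the two-block `(𝐔, 𝐉)` chart of (1.9) (the `𝐉`-block is a second copy of the adjoint
representation, (1.10) `𝐉 ↦ R(u)𝐉`; still no trivial summand). [cite: Balaban1987RG1, (1.10) p.262, (4.13)–(4.14) p.284] -/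
theorem noInvariantCovectorAtJ (K : ℕ) : NoInvariantCovectorAtJ F K := by
  classical
  intro φ hφ
  have hinv : ∀ (g : SU 2) (w : Fin (recordChartDimJ F K) → ℂ), φ (recordAdJ F K g w) = φ w := fun g w => by
    simpa using DFunLike.congr_fun (hφ g) w
  let P : (Fin (recordChartDimJ F K) → ℂ) → (Fin (recordChartDimJ F K) → ℂ) := fun w i =>
    if ((chartEquivJ F K).symm i).2 = Sum.inl 2 ∨ ((chartEquivJ F K).symm i).2 = Sum.inr 2 then w i else 0
  have h1 : ∀ w, w + recordAdJ F K ⟨_, rotDiag_mem⟩ w = (2 : ℂ) • P w := by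
    intro w; ext i
    obtain ⟨⟨b, c⟩, rfl⟩ := (chartEquivJ F K).surjective i
    rcases c with a | a
    · rw [Pi.add_apply, Pi.smul_apply, recordAdJ_rotDiag_inl]
      fin_cases a
      · simp [P]
      · simp [P]
      · simp [P]; ring
    · rw [Pi.add_apply, Pi.smul_apply, recordAdJ_rotDiag_inr]
      fin_cases a
      · simp [P]
      · simp [P]
      · simp [P]; ring
  have h2 : ∀ w, recordAdJ F K ⟨_, rotWeyl_mem⟩ (P w) = -P w := by
    intro w; ext i
    obtain ⟨⟨b, c⟩, rfl⟩ := (chartEquivJ F K).surjective i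
    rcases c with a | a
    · rw [Pi.neg_apply, recordAdJ_rotWeyl_inl]
      fin_cases a <;> simp [P]
    · rw [Pi.neg_apply, recordAdJ_rotWeyl_inr]
      fin_cases a <;> simp [P]
  have hP : ∀ w, φ (P w) = 0 := by
    intro w
    have h := hinv ⟨_, rotWeyl_mem⟩ (P w)
    rw [h2, map_neg] at h
    linear_combination (-1 / 2 : ℂ) * h
  refine ContinuousLinearMap.ext fun w => ?_
  have h3 : φ (w + recordAdJ F K ⟨_, rotDiag_mem⟩ w) = 2 * φ w := by rw [map_add, hinv]; ring
  rw [h1, map_smul, hP, smul_zero] at h3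
  show φ w = 0
  linear_combination (-1 / 2 : ℂ) * h3

/-! ## §3  ★ (4.8) with a CONSTANT `λ` AT THE RECORD: the record's charts intertwine the constant rotations with the (1.10) action —
`exp(Ad_h W) = h·exp(W)·h⁻¹` on the bonds of `X`, `1 = h·1·h⁻¹` off `X`, `𝐉 ↦ h𝐉h⁻¹`; lens-1's ROW `ChartEquivariantAt(J)`, PROVED for both chart editions -/

/-- The trace of a conjugate of a chart matrix vanishes. [cite: Balaban1987RG1, (1.10) p.262 (bookkeeping)] -/
theorem trace_units_conj_eq_zero (u : (MatA 2)ˣ) {M : MatA 2} (hM : M.trace = 0) :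
    ((u : MatA 2) * M * ((u⁻¹ : (MatA 2)ˣ) : MatA 2)).trace = 0 := by
  rw [Matrix.trace_mul_cycle, Units.inv_mul, one_mul, hM]

/-- **The chart matrix of rotated coordinates is the conjugated chart matrix**: `Σ_a (Ad_h w)_{b,a} τ_a = h (Σ_a w_{b,a} τ_a) h⁻¹`.
[cite: Balaban1987RG1, (4.8) p.283] -/
theorem chartMat_recordAd (K : ℕ) (h : SU 2) (w : Fin (recordChartDim F K) → ℂ) (b : PBond (F.P K) 0) :
    chartMat F K (recordAd F K h w) b = ((ιSU 2 h : (MatA 2)ˣ) : MatA 2) * chartMat F K w b * (((ιSU 2 h)⁻¹ : (MatA 2)ˣ) : MatA 2) := by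
  have hfun : recordAd F K h w = fun i => sl2Coord
      ((fun b' => ((ιSU 2 h : (MatA 2)ˣ) : MatA 2) * chartMat F K w b' * (((ιSU 2 h)⁻¹ : (MatA 2)ˣ) : MatA 2))
        ((chartEquiv F K).symm i).1) ((chartEquiv F K).symm i).2 := by
    ext i; rw [recordAd_apply, coe_inv_SU2_eq_units_inv]; rfl
  rw [hfun]
  exact chartMat_sl2Coord_of_trace_eq_zero F K _ (fun b' => trace_units_conj_eq_zero (ιSU 2 h) (PortU2.trace_chartMat F K w b')) b

/-- **★ `ChartEquivariantAt F Mc k` HOLDS** — (4.8) p.283 with a constant `λ`: `exp(i Ad_h B) = h exp(iB) h⁻¹`, for the record's exp-chart cut to `X`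
(`recordChart`) against the (1.10) action `recordAct` of the constant gauge transformation `recordToG h`: on the bonds of `X` by `Matrix.exp_units_conj`,
off `X` by `h·1·h⁻¹ = 1`, on the `𝐉`-slot by `h·0·h⁻¹ = 0`. [cite: Balaban1987RG1, (4.8) p.283, (1.10) p.262] -/
theorem chartEquivariantAt (Mc k : ℕ) : ChartEquivariantAt F Mc k := by
  classical
  intro K X h u
  unfold recordAct
  rw [recordChart, recordChart, decodeCfg_encodeCfg]
  congr 1
  refine Prod.ext (funext fun b => ?_) (funext fun b => ?_)
  · show (if b ∈ domBonds F Mc k K X then exp (chartMat F K (recordAd F K h u) b) else 1) =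
      ((ιSU 2 h : (MatA 2)ˣ) : MatA 2) * (if b ∈ domBonds F Mc k K X then exp (chartMat F K u b) else 1) *
        (((ιSU 2 h)⁻¹ : (MatA 2)ˣ) : MatA 2)
    split_ifs with hb
    · rw [chartMat_recordAd, Matrix.exp_units_conj]
    · rw [mul_one, Units.mul_inv]
  · show (0 : MatA 2) = ((ιSU 2 h : (MatA 2)ˣ) : MatA 2) * 0 * (((ιSU 2 h)⁻¹ : (MatA 2)ˣ) : MatA 2)
    rw [mul_zero, zero_mul]

/-- The `𝐔`-block chart matrix of rotated two-block coordinates is the conjugated one. [cite: Balaban1987RG1, (4.8) p.283, (1.10) p.262] -/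
theorem chartMatU_recordAdJ (K : ℕ) (h : SU 2) (w : Fin (recordChartDimJ F K) → ℂ) (b : PBond (F.P K) 0) :
    chartMatU F K (recordAdJ F K h w) b = ((ιSU 2 h : (MatA 2)ˣ) : MatA 2) * chartMatU F K w b * (((ιSU 2 h)⁻¹ : (MatA 2)ˣ) : MatA 2) := by
  have htr : ∀ b', (chartMatU F K w b').trace = 0 := fun b' => by
    simp [chartMatU, Matrix.trace_sum, Matrix.trace_smul, PortU2.trace_sl2Gen]
  have hco : ∀ a, recordAdJ F K h w (chartEquivJ F K (b, Sum.inl a)) =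
      sl2Coord (((ιSU 2 h : (MatA 2)ˣ) : MatA 2) * chartMatU F K w b * (((ιSU 2 h)⁻¹ : (MatA 2)ˣ) : MatA 2)) a := fun a => by
    rw [recordAdJ_apply, Equiv.symm_apply_apply, Sum.elim_inl, coe_inv_SU2_eq_units_inv]; rfl
  simp only [chartMatU, hco]
  exact sum_sl2Coord_smul_sl2Gen_of_trace_eq_zero (trace_units_conj_eq_zero (ιSU 2 h) (htr b))

/-- The `𝐉`-block chart matrix of rotated two-block coordinates is the conjugated one ((1.10): `𝐉 ↦ R(u)𝐉`). [cite: Balaban1987RG1, (1.10) p.262, (4.8) p.283] -/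
theorem chartMatJc_recordAdJ (K : ℕ) (h : SU 2) (w : Fin (recordChartDimJ F K) → ℂ) (b : PBond (F.P K) 0) :
    chartMatJc F K (recordAdJ F K h w) b = ((ιSU 2 h : (MatA 2)ˣ) : MatA 2) * chartMatJc F K w b * (((ιSU 2 h)⁻¹ : (MatA 2)ˣ) : MatA 2) := by
  have htr : ∀ b', (chartMatJc F K w b').trace = 0 := fun b' => by
    simp [chartMatJc, Matrix.trace_sum, Matrix.trace_smul, PortU2.trace_sl2Gen]
  have hco : ∀ a, recordAdJ F K h w (chartEquivJ F K (b, Sum.inr a)) =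
      sl2Coord (((ιSU 2 h : (MatA 2)ˣ) : MatA 2) * chartMatJc F K w b * (((ιSU 2 h)⁻¹ : (MatA 2)ˣ) : MatA 2)) a := fun a => by
    rw [recordAdJ_apply, Equiv.symm_apply_apply, Sum.elim_inr, coe_inv_SU2_eq_units_inv]; rfl
  simp only [chartMatJc, hco]
  exact sum_sl2Coord_smul_sl2Gen_of_trace_eq_zero (trace_units_conj_eq_zero (ιSU 2 h) (htr b))

/-- **★ `ChartEquivariantAtJ F Mc k` HOLDS** — (4.8) with a constant `λ` for the two-block `(𝐔, 𝐉)` chart `recordChartJ`: `(exp(Ad_h W_U), Ad_h W_J)` on the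
bonds of `X`, `(1, 0)` off `X`, equals the (1.10) image `(h𝐔h⁻¹, h𝐉h⁻¹)` of `(exp W_U, W_J)` under the constant gauge transformation `recordToG h`.
[cite: Balaban1987RG1, (4.8) p.283, (1.10) p.262, (1.9) p.261] -/
theorem chartEquivariantAtJ (Mc k : ℕ) : ChartEquivariantAtJ F Mc k := by
  classical
  intro K X h u
  unfold recordAct
  rw [recordChartJ, recordChartJ, decodeCfg_encodeCfg]
  congr 1
  refine Prod.ext (funext fun b => ?_) (funext fun b => ?_)
  · show (if b ∈ domBonds F Mc k K X then exp (chartMatU F K (recordAdJ F K h u) b) else 1) =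
      ((ιSU 2 h : (MatA 2)ˣ) : MatA 2) * (if b ∈ domBonds F Mc k K X then exp (chartMatU F K u b) else 1) *
        (((ιSU 2 h)⁻¹ : (MatA 2)ˣ) : MatA 2)
    split_ifs with hb
    · rw [chartMatU_recordAdJ, Matrix.exp_units_conj]
    · rw [mul_one, Units.mul_inv]
  · show (if b ∈ domBonds F Mc k K X then chartMatJc F K (recordAdJ F K h u) b else 0) =
      ((ιSU 2 h : (MatA 2)ˣ) : MatA 2) * (if b ∈ domBonds F Mc k K X then chartMatJc F K u b else 0) *
        (((ιSU 2 h)⁻¹ : (MatA 2)ˣ) : MatA 2)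
    split_ifs with hb
    · rw [chartMatJc_recordAdJ]
    · rw [mul_zero, zero_mul]

end Summit.QuantumFields.YangMills.Theorems.BalabanUVNodesPortS1

end
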